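import Literature.Computability.AlgebraicComplexity.BI17TensorGenericFiniteStabilizer
import HarnessLib

/-!
# The bad locus `{w : the traceless infinitesimal stabilizer of w is non-zero}` is closed and `SL³`-stable

Programme-#5 brick T2 of the val-lit cell (tensor Popov-70 / BI 2017 Prop. 4.10 by the Mumford
route: T1 `TripleOrbitClosedOfNoFixedTorus`, T3 `TensorInvariantSeparation`, T4
`BI17TensorGenericWitness`, T5 assembly). For `w ∈ ⊗³ℂ^ι` let `P w := HasTrivialSL3LieStabilizer w`
(`BI17TensorFiniteStabilizerLocusProofs`: the only traceless triple `(X,Y,Z)` with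
`(X ⊗ 1 ⊗ 1 + 1 ⊗ Y ⊗ 1 + 1 ⊗ 1 ⊗ Z)·w = 0` is `0`). This file supplies the two inputs about the
bad locus `B = {w : ¬ P w}` that the invariant-separation step (GIT Ch. 1 §2 Cor. 1.2, brick T3,
`IsPolystableTensor.exists_isSL3Invariant_ne_zero_of_not`) consumes, in exactly its hypothesis
shapes:

* `exists_setOf_not_hasTrivialSL3LieStabilizer_iff` — `B` is Zariski closed: there is a set `T` of
  polynomials in the `m³` coordinates (the maximal minors of the generic `sl3LieMatrix`) with
  `¬ P w ↔ ∀ Φ ∈ T, Φ(w) = 0`;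
* `not_hasTrivialSL3LieStabilizer_actTensor` — `B` is `SL³`-stable (indeed `GL³`-stable,
  `hasTrivialSL3LieStabilizer_actTensor_iff`): conjugating a kernel triple by `g` gives a kernel
  triple for `g·w`.

Theorem-only file (no definitions, no named facts). Honest framing: linear algebra; nothing here
bears on VP versus VNP.
[cite: BurgisserIkenmeyer2017, §4.1 eq. (4.1) and Prop. 4.10 (proof)]

## References

* P. Bürgisser, C. Ikenmeyer, *Fundamental invariants of orbit closures*, J. Algebra 477 (2017),
  §4.1–4.2, Prop. 4.10. [BurgisserIkenmeyer2017]
* D. Mumford, J. Fogarty, F. Kirwan, *Geometric Invariant Theory*, 3rd ed. (1994), Ch. 1 §2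
  Cor. 1.2. [MumfordFogartyKirwan1994]

## Tree

`HasTrivialSL3LieStabilizer`, `sl3LieMatrix`, `sl3LieMatrix_map`,
`hasTrivialSL3LieStabilizer_of_mulVec_injective` (`BI17TensorFiniteStabilizerLocusProofs`);
`mulVec_injective_of_hasTrivialSL3LieStabilizer` (`BI17TensorGenericFiniteStabilizer`);
`actTensor_actTensor`, `actTensor_one`, `actTensor_zero` (`QuantumFunctionals*`).
-/

set_option Elab.async false

noncomputable section

namespace Literature.Computability.AlgebraicComplexity

open MvPolynomial

/-! ### `GL³`-stability of the bad locus -/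

section Stable

variable {ι : Type*} [Fintype ι] [DecidableEq ι] {K : Type*} [Field K]

/-- **Conjugation transports kernel triples**: if `A, B, C` are invertible and the traceless
infinitesimal stabilizer of `(A ⊗ B ⊗ C)·w` is zero, then so is that of `w` — a traceless kernel
triple `(X,Y,Z)` of `w` gives the traceless kernel triple `(AXA⁻¹, BYB⁻¹, CZC⁻¹)` of
`(A ⊗ B ⊗ C)·w`. [cite: BurgisserIkenmeyer2017, §4.1 eq. (4.1) (stabilizers of translates are conjugate)] -/
theorem HasTrivialSL3LieStabilizer.of_actTensor {A B C : Matrix ι ι K} (hA : IsUnit A.det)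
    (hB : IsUnit B.det) (hC : IsUnit C.det) {w : ι → ι → ι → K}
    (h : HasTrivialSL3LieStabilizer (actTensor A B C w)) : HasTrivialSL3LieStabilizer w := by
  intro X Y Z hX hY hZ hL
  have hA' : A⁻¹ * A = 1 := Matrix.nonsing_inv_mul A hA
  have hB' : B⁻¹ * B = 1 := Matrix.nonsing_inv_mul B hB
  have hC' : C⁻¹ * C = 1 := Matrix.nonsing_inv_mul C hC
  have hAA : A * A⁻¹ = 1 := Matrix.mul_nonsing_inv A hA
  have hBB : B * B⁻¹ = 1 := Matrix.mul_nonsing_inv B hB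
  have hCC : C * C⁻¹ = 1 := Matrix.mul_nonsing_inv C hC
  -- traces of conjugates
  have htr : ∀ {P M : Matrix ι ι K}, P⁻¹ * P = 1 → M.trace = 0 → (P * M * P⁻¹).trace = 0 := by
    intro P M hP hM
    rw [Matrix.trace_mul_comm, ← Matrix.mul_assoc, hP, Matrix.one_mul, hM]
  -- the conjugated triple kills `(A ⊗ B ⊗ C)·w`
  have hL' : actTensor (A * X * A⁻¹) (1 : Matrix ι ι K) (1 : Matrix ι ι K) (actTensor A B C w) +
      actTensor (1 : Matrix ι ι K) (B * Y * B⁻¹) (1 : Matrix ι ι K) (actTensor A B C w) +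
      actTensor (1 : Matrix ι ι K) (1 : Matrix ι ι K) (C * Z * C⁻¹) (actTensor A B C w) = 0 := by
    have e₁ : actTensor (A * X * A⁻¹) (1 : Matrix ι ι K) (1 : Matrix ι ι K) (actTensor A B C w) =
        actTensor A B C (actTensor X (1 : Matrix ι ι K) (1 : Matrix ι ι K) w) := by
      rw [actTensor_actTensor, actTensor_actTensor, Matrix.mul_assoc, hA', Matrix.mul_one,
        Matrix.one_mul, Matrix.one_mul, Matrix.mul_one, Matrix.mul_one]
    have e₂ : actTensor (1 : Matrix ι ι K) (B * Y * B⁻¹) (1 : Matrix ι ι K) (actTensor A B C w) =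
        actTensor A B C (actTensor (1 : Matrix ι ι K) Y (1 : Matrix ι ι K) w) := by
      rw [actTensor_actTensor, actTensor_actTensor, Matrix.mul_assoc, hB', Matrix.mul_one,
        Matrix.one_mul, Matrix.one_mul, Matrix.mul_one, Matrix.mul_one]
    have e₃ : actTensor (1 : Matrix ι ι K) (1 : Matrix ι ι K) (C * Z * C⁻¹) (actTensor A B C w) =
        actTensor A B C (actTensor (1 : Matrix ι ι K) (1 : Matrix ι ι K) Z w) := by
      rw [actTensor_actTensor, actTensor_actTensor, Matrix.mul_assoc, hC', Matrix.mul_one,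
        Matrix.one_mul, Matrix.one_mul, Matrix.mul_one, Matrix.mul_one]
    rw [e₁, e₂, e₃, ← actTensor_add_tensor, ← actTensor_add_tensor, hL, actTensor_zero]
  obtain ⟨h₁, h₂, h₃⟩ := h _ _ _ (htr hA' hX) (htr hB' hY) (htr hC' hZ) hL'
  -- undo the conjugation
  have back : ∀ {P M : Matrix ι ι K}, P⁻¹ * P = 1 → P * P⁻¹ = 1 → P * M * P⁻¹ = 0 → M = 0 := by
    intro P M hP hPP h0
    calc M = P⁻¹ * (P * M * P⁻¹) * P := by
          rw [Matrix.mul_assoc, Matrix.mul_assoc, hP, Matrix.mul_one, ← Matrix.mul_assoc, hP,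
            Matrix.one_mul]
      _ = 0 := by rw [h0, Matrix.mul_zero, Matrix.zero_mul]
  exact ⟨back hA' hAA h₁, back hB' hBB h₂, back hC' hCC h₃⟩

/-- **The trivial-infinitesimal-stabilizer locus is `GL³`-invariant.**
[cite: BurgisserIkenmeyer2017, §4.1 eq. (4.1) (stabilizers of translates are conjugate)] -/
theorem hasTrivialSL3LieStabilizer_actTensor_iff {A B C : Matrix ι ι K} (hA : IsUnit A.det)
    (hB : IsUnit B.det) (hC : IsUnit C.det) (w : ι → ι → ι → K) :
    HasTrivialSL3LieStabilizer (actTensor A B C w) ↔ HasTrivialSL3LieStabilizer w := by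
  refine ⟨fun h => h.of_actTensor hA hB hC, fun h => ?_⟩
  have hA' : IsUnit A⁻¹.det := by rw [Matrix.det_nonsing_inv]; exact hA.ringInverse
  have hB' : IsUnit B⁻¹.det := by rw [Matrix.det_nonsing_inv]; exact hB.ringInverse
  have hC' : IsUnit C⁻¹.det := by rw [Matrix.det_nonsing_inv]; exact hC.ringInverse
  refine HasTrivialSL3LieStabilizer.of_actTensor hA' hB' hC' ?_
  rwa [actTensor_actTensor, Matrix.nonsing_inv_mul A hA, Matrix.nonsing_inv_mul B hB,
    Matrix.nonsing_inv_mul C hC, actTensor_one]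

/-- **`SL³`-stability of the bad locus**, in the shape consumed by the separation step
(`IsPolystableTensor.exists_isSL3Invariant_ne_zero_of_not`, hypothesis `hPst`, with
`P := HasTrivialSL3LieStabilizer`). [cite: BurgisserIkenmeyer2017, §4.1 eq. (4.1) and Prop. 4.10 (proof)] -/
theorem not_hasTrivialSL3LieStabilizer_actTensor
    (g : Matrix.SpecialLinearGroup ι K × Matrix.SpecialLinearGroup ι K ×
      Matrix.SpecialLinearGroup ι K)
    (w : ι → ι → ι → K) (h : ¬ HasTrivialSL3LieStabilizer w) :
    ¬ HasTrivialSL3LieStabilizer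
      (actTensor (g.1 : Matrix ι ι K) (g.2.1 : Matrix ι ι K) (g.2.2 : Matrix ι ι K) w) := by
  have hdet : ∀ γ : Matrix.SpecialLinearGroup ι K, IsUnit (γ : Matrix ι ι K).det := fun γ => by
    rw [γ.det_coe]; exact isUnit_one
  exact fun h' => h (h'.of_actTensor (hdet g.1) (hdet g.2.1) (hdet g.2.2))

end Stable

/-! ### Zariski-closedness of the bad locus -/

section Closed

variable {ι : Type*} [Fintype ι] [DecidableEq ι]

/-- A matrix over `ℂ` with injective `mulVec` has a non-singular square submatrix on some rows.
[folklore] -/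
private theorem exists_submatrix_det_ne_zero {ρ κ : Type*} [Fintype ρ] [Fintype κ] [DecidableEq κ]
    (A : Matrix ρ κ ℂ) (hA : Function.Injective A.mulVec) :
    ∃ e : κ → ρ, (A.submatrix e id).det ≠ 0 := by
  classical
  have hrank : A.rank = Fintype.card κ := by
    have hinj : Function.Injective A.mulVecLin := fun x y hxy => hA hxy
    rw [Matrix.rank, LinearMap.finrank_range_of_inj hinj, Module.finrank_fintype_fun_eq_card]
  obtain ⟨κ', a, ha, hspan, hli⟩ := exists_linearIndependent' (K := ℂ) A.row
  haveI : Finite κ' := hli.finite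
  letI : Fintype κ' := Fintype.ofFinite κ'
  have hcard : Fintype.card κ' = Fintype.card κ := by
    rw [linearIndependent_iff_card_eq_finrank_span.mp hli, Set.finrank, hspan,
      ← Matrix.rank_eq_finrank_span_row, hrank]
  obtain ⟨e⟩ : Nonempty (κ ≃ κ') := Fintype.card_eq.mp hcard.symm
  refine ⟨a ∘ e, ?_⟩
  have hli' : LinearIndependent ℂ (A.submatrix (a ∘ e) id).row := by
    have : (A.submatrix (a ∘ e) id).row = (A.row ∘ a) ∘ e := by
      funext i; rfl
    rw [this]
    exact hli.comp e e.injective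
  have hU := Matrix.linearIndependent_rows_iff_isUnit.mp hli'
  rw [Matrix.isUnit_iff_isUnit_det] at hU
  exact hU.ne_zero

/-- A non-singular maximal minor of `sl3LieMatrix w` makes `mulVec` injective, hence the
traceless infinitesimal stabilizer zero. [cite: BurgisserIkenmeyer2017, §4.1 and Prop. 4.10 (proof)] -/
theorem hasTrivialSL3LieStabilizer_of_submatrix_det_ne_zero (w : ι → ι → ι → ℂ)
    (e : Fin 3 × ι × ι → (ι × ι × ι) ⊕ Fin 3) (he : ((sl3LieMatrix w).submatrix e id).det ≠ 0) :
    HasTrivialSL3LieStabilizer w := by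
  apply hasTrivialSL3LieStabilizer_of_mulVec_injective
  intro v v' hvv'
  rw [← sub_eq_zero]
  apply Matrix.eq_zero_of_mulVec_eq_zero he
  rw [Matrix.mulVec_sub]
  have h1 : ((sl3LieMatrix w).submatrix e id).mulVec v =
      ((sl3LieMatrix w).submatrix e id).mulVec v' := by
    funext i
    have := congr_fun hvv' (e i)
    simpa [Matrix.mulVec, dotProduct, Matrix.submatrix_apply] using this
  rw [h1, sub_self]

/-- **The bad locus is Zariski closed**, in the shape consumed by the separation step
(`IsPolystableTensor.exists_isSL3Invariant_ne_zero_of_not`, hypothesis `hPcl`, with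
`P := HasTrivialSL3LieStabilizer`): `¬ P w` iff all maximal minors of the generic `sl3LieMatrix`
vanish at `w`. [cite: BurgisserIkenmeyer2017, §4.1 and Prop. 4.10 (proof)] -/
theorem exists_setOf_not_hasTrivialSL3LieStabilizer_iff :
    ∃ T : Set (MvPolynomial (ι × ι × ι) ℂ), ∀ w : ι → ι → ι → ℂ,
      ¬ HasTrivialSL3LieStabilizer w ↔ ∀ Φ ∈ T, aeval (tensorPt w) Φ = 0 := by
  classical
  let Mgen : Matrix ((ι × ι × ι) ⊕ Fin 3) (Fin 3 × ι × ι) (MvPolynomial (ι × ι × ι) ℂ) :=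
    sl3LieMatrix fun a b c => X (a, b, c)
  refine ⟨Set.range fun e : Fin 3 × ι × ι → (ι × ι × ι) ⊕ Fin 3 => (Mgen.submatrix e id).det,
    fun w => ?_⟩
  have hevalM : Mgen.map (aeval (tensorPt w)) = sl3LieMatrix w := by
    show (sl3LieMatrix fun a b c => (X (a, b, c) : MvPolynomial (ι × ι × ι) ℂ)).map
      (aeval (tensorPt w)) = sl3LieMatrix w
    rw [sl3LieMatrix_map]
    congr 1
    funext a b c
    rw [aeval_X]
    rfl
  have hevalF : ∀ e : Fin 3 × ι × ι → (ι × ι × ι) ⊕ Fin 3,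
      aeval (tensorPt w) (Mgen.submatrix e id).det = ((sl3LieMatrix w).submatrix e id).det := by
    intro e
    rw [AlgHom.map_det, AlgHom.mapMatrix_apply, ← Matrix.submatrix_map, hevalM]
  constructor
  · intro hnot Φ hΦ
    obtain ⟨e, rfl⟩ := hΦ
    rw [hevalF]
    by_contra hne
    exact hnot (hasTrivialSL3LieStabilizer_of_submatrix_det_ne_zero w e hne)
  · intro hall htriv
    obtain ⟨e, he⟩ := exists_submatrix_det_ne_zero _
      (mulVec_injective_of_hasTrivialSL3LieStabilizer w htriv)
    exact he (by rw [← hevalF]; exact hall _ ⟨e, rfl⟩)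

end Closed

end Literature.Computability.AlgebraicComplexity

end
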